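import Mathlib.Analysis.Complex.CauchyIntegral
import Literature.Analysis.Complex.DbarBumpResidue
import HarnessLib

/-!
# Green's formula on a half-plane for a holomorphic function continuous up to the edge
(crux `BoundaryClosureR`, stmt-CriticalPhenomena-14004, line `polygon-parity-squeeze`, stub
`stub_gateTrace`, mechanism (C); registered sub-goal `gateTrace_green_halfPlane`)

For `u` holomorphic on `{im > h} ∩ V` and continuous on `{im ≥ h} ∩ V` (`V` open) and a test
function `φ ∈ C¹_c` with `tsupport φ ⊆ V`,

  `∫_{im z > h} ∂̄φ · u dA = -(i/2) ∫_ℝ φ(x + ih) u(x + ih) dx`          (`∂̄ = ½(∂ₓ + i∂_y)`),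

i.e. `∂̄(u 1_{im > h}) = (i/2) u(x + ih) dx` in the sense of distributions: the CANDIDATE side of the
gate identity of the line (the candidate `c · exp((5/8)(L − L_b))` is holomorphic in the carrier and
continuous up to the open flat gate).  Proof: Green's theorem for real-differentiable functions on a
rectangle `[a, b] × [h, M]` containing `tsupport φ ∩ {im ≥ h}` (Mathlib's
`Complex.integral_boundary_rect_of_hasFDerivAt_real_off_countable`, applied to `φ u` with the
Cauchy–Riemann derivative of `u`, so that `i ∂ₓ(φu) − ∂_y(φu) = 2i ∂̄φ · u` exactly), three sides of
which carry no mass, and Fubini (`ℂ ≃ ℝ × ℝ` is measure preserving).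
-/

noncomputable section

open scoped Topology ContDiff Interval
open Filter Set Metric MeasureTheory Complex
open Literature.Analysis.Complex (dbarAlong dbarAlong_one dbarAlong_eq_zero_of_notMem_tsupport
  continuous_dbarAlong_one tsupport_dbarAlong_one_subset)

namespace Summit.CriticalPhenomena.SAWScalingLimit.Theorems.PolygonParitySqueeze.GateTrace

/-- A continuous `ψ` supported inside an open `V` times a function continuous on `T ∩ V` is
continuous on `T` (off `V` the product vanishes near every point). [folklore] -/
theorem continuousOn_mul_of_tsupport_subset {ψ u : ℂ → ℂ} {V T : Set ℂ} (hV : IsOpen V)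
    (hψ : Continuous ψ) (hψV : tsupport ψ ⊆ V) (hu : ContinuousOn u (T ∩ V)) :
    ContinuousOn (fun z => ψ z * u z) T := by
  intro z hz
  by_cases hzV : z ∈ V
  · have huz : ContinuousWithinAt u T z :=
      (hu z ⟨hz, hzV⟩).mono_of_mem_nhdsWithin (inter_mem_nhdsWithin T (hV.mem_nhds hzV))
    exact hψ.continuousWithinAt.mul huz
  · have hz' : z ∉ tsupport ψ := fun h => hzV (hψV h)
    have hev : (fun _ => (0 : ℂ)) =ᶠ[𝓝 z] fun w => ψ w * u w := by
      filter_upwards [(isClosed_tsupport ψ).isOpen_compl.mem_nhds hz'] with w hw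
      rw [image_eq_zero_of_notMem_tsupport hw, zero_mul]
    exact (continuousAt_const.congr hev).continuousWithinAt

/-- The norm of a complex number dominates the absolute values of its coordinates; hence a point
with a coordinate of absolute value `≥ R` lies outside every set contained in `B̄(0, R')`, `R' < R`.
[folklore] -/
theorem not_mem_of_le_abs_re_or_im {s : Set ℂ} {R' R : ℝ} (hs : s ⊆ closedBall (0 : ℂ) R')
    (hR : R' < R) {z : ℂ} (hz : R ≤ |z.re| ∨ R ≤ |z.im|) : z ∉ s := by
  intro hmem
  have h1 : ‖z‖ ≤ R' := mem_closedBall_zero_iff.1 (hs hmem)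
  rcases hz with h | h
  · linarith [Complex.abs_re_le_norm z]
  · linarith [Complex.abs_im_le_norm z]

/-- **Green's formula on a half-plane** (registered sub-goal `gateTrace_green_halfPlane` of stub
`stub_gateTrace`): for `u` holomorphic on `{im > h} ∩ V`, continuous on `{im ≥ h} ∩ V`, and
`φ ∈ C¹_c` supported in the open set `V`,
`∫_{im > h} ∂̄φ · u dA = -(i/2) ∫ φ(x + ih) u(x + ih) dx`. [folklore] -/
theorem setIntegral_dbarAlong_mul_eq_boundary {u φ : ℂ → ℂ} {h : ℝ} {V : Set ℂ} (hV : IsOpen V)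
    (hu : DifferentiableOn ℂ u ({z : ℂ | h < z.im} ∩ V))
    (huc : ContinuousOn u ({z : ℂ | h ≤ z.im} ∩ V))
    (hφ : ContDiff ℝ 1 φ) (hφc : HasCompactSupport φ) (hφV : tsupport φ ⊆ V) :
    ∫ z in {z : ℂ | h < z.im}, dbarAlong 1 φ z * u z =
      -(I / 2) * ∫ x : ℝ, φ ((x : ℂ) + (h : ℂ) * I) * u ((x : ℂ) + (h : ℂ) * I) := by
  ---------------------------------------------------------------- a box around the support
  obtain ⟨Rb, hRb⟩ : ∃ R : ℝ, tsupport φ ⊆ closedBall (0 : ℂ) R :=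
    (isBounded_iff_subset_closedBall 0).1 hφc.isCompact.isBounded
  set R₁ : ℝ := max Rb 0 + 1 with hR₁def
  have hRbR₁ : Rb < R₁ := by rw [hR₁def]; linarith [le_max_left Rb 0]
  have hR₁ : 0 < R₁ := by rw [hR₁def]; linarith [le_max_right Rb 0]
  have hout : ∀ z : ℂ, R₁ ≤ |z.re| ∨ R₁ ≤ |z.im| → z ∉ tsupport φ := fun z hz =>
    not_mem_of_le_abs_re_or_im hRb hRbR₁ hz
  have hφ0 : ∀ z : ℂ, R₁ ≤ |z.re| ∨ R₁ ≤ |z.im| → φ z = 0 := fun z hz =>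
    image_eq_zero_of_notMem_tsupport (hout z hz)
  have hdφ0 : ∀ z : ℂ, R₁ ≤ |z.re| ∨ R₁ ≤ |z.im| → dbarAlong 1 φ z = 0 := fun z hz =>
    dbarAlong_eq_zero_of_notMem_tsupport (hout z hz)
  set a : ℝ := -R₁ with ha
  set b : ℝ := R₁ with hb
  set M : ℝ := max R₁ (h + 1) with hM
  have hab : a ≤ b := by rw [ha, hb]; linarith
  have hhM : h < M := lt_of_lt_of_le (by linarith) (le_max_right R₁ (h + 1))
  have hR₁M : R₁ ≤ M := le_max_left _ _
  ---------------------------------------------------------------- `G = φ u`, `Ψ = ∂̄φ u`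
  set G : ℂ → ℂ := fun z => φ z * u z with hGdef
  set Ψ : ℂ → ℂ := fun z => dbarAlong 1 φ z * u z with hΨdef
  have hcontG : ContinuousOn G {z : ℂ | h ≤ z.im} :=
    continuousOn_mul_of_tsupport_subset hV hφ.continuous hφV huc
  have hcontΨ : ContinuousOn Ψ {z : ℂ | h ≤ z.im} :=
    continuousOn_mul_of_tsupport_subset hV (continuous_dbarAlong_one hφ)
      ((tsupport_dbarAlong_one_subset φ).trans hφV) huc
  ---------------------------------------------------------------- the rectangle `[a,b] × [h,M]`
  have hrect : ([[a, b]] ×ℂ [[h, M]]) ⊆ {z : ℂ | h ≤ z.im} := by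
    intro z hz
    have h2 : z.im ∈ [[h, M]] := hz.2
    rw [uIcc_of_le hhM.le] at h2
    exact h2.1
  have hK : IsCompact ([[a, b]] ×ℂ [[h, M]]) := isCompact_uIcc.reProdIm isCompact_uIcc
  -- the real derivative of `G` (Cauchy–Riemann form for the `u`-factor)
  set f' : ℂ → ℂ →L[ℝ] ℂ := fun z =>
    φ z • ((ContinuousLinearMap.smulRight (1 : ℂ →L[ℂ] ℂ) (deriv u z)).restrictScalars ℝ) +
      u z • fderiv ℝ φ z with hf'def
  have hf'I : ∀ z, I • f' z 1 - f' z I = 2 * I * Ψ z := by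
    intro z
    simp only [hf'def, hΨdef, dbarAlong_one, add_apply, FunLike.coe_smul, Pi.smul_apply,
      ContinuousLinearMap.coe_restrictScalars', ContinuousLinearMap.smulRight_apply,
      one_apply_eq_self, smul_eq_mul]
    ring_nf
    rw [I_sq]
    ring
  have Hd : ∀ z ∈ (Ioo (min a b) (max a b) ×ℂ Ioo (min h M) (max h M)) \ (∅ : Set ℂ),
      HasFDerivAt G (f' z) z := by
    rintro z ⟨hz, -⟩
    rw [min_eq_left hab, max_eq_right hab, min_eq_left hhM.le, max_eq_right hhM.le] at hz
    by_cases hzs : z ∈ tsupport φ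
    · have hzU : z ∈ {z : ℂ | h < z.im} ∩ V := ⟨hz.2.1, hφV hzs⟩
      have hud : DifferentiableAt ℂ u z :=
        hu.differentiableAt (((isOpen_lt continuous_const Complex.continuous_im).inter hV).mem_nhds hzU)
      have hu' : HasFDerivAt u
          ((ContinuousLinearMap.smulRight (1 : ℂ →L[ℂ] ℂ) (deriv u z)).restrictScalars ℝ) z :=
        hud.hasDerivAt.hasFDerivAt.restrictScalars ℝ
      have hφ' : HasFDerivAt φ (fderiv ℝ φ z) z := (hφ.differentiable one_ne_zero z).hasFDerivAt
      exact hφ'.mul hu'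
    · have hzero : f' z = 0 := by
        show φ z • _ + u z • fderiv ℝ φ z = 0
        rw [image_eq_zero_of_notMem_tsupport hzs, fderiv_of_notMem_tsupport ℝ hzs, zero_smul,
          smul_zero, add_zero]
      have hev : G =ᶠ[𝓝 z] fun _ => 0 := by
        filter_upwards [(isClosed_tsupport φ).isOpen_compl.mem_nhds hzs] with w hw
        simp only [hGdef, image_eq_zero_of_notMem_tsupport hw, zero_mul]
      rw [hzero]
      exact (hasFDerivAt_const (0 : ℂ) z).congr_of_eventuallyEq hev
  have Hc : ContinuousOn G ([[a, b]] ×ℂ [[h, M]]) := hcontG.mono hrect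
  have Hi : IntegrableOn (fun z => I • f' z 1 - f' z I) ([[a, b]] ×ℂ [[h, M]]) := by
    have e : (fun z => I • f' z 1 - f' z I) = fun z => 2 * I * Ψ z := funext hf'I
    rw [e]
    exact ((hcontΨ.mono hrect).integrableOn_compact hK).const_mul _
  have key := Complex.integral_boundary_rect_of_hasFDerivAt_real_off_countable G f'
    ⟨a, h⟩ ⟨b, M⟩ ∅ countable_empty Hc Hd Hi
  dsimp only at key
  have hre : ∀ x y : ℝ, ((x : ℂ) + (y : ℂ) * I).re = x := by intro x y; simp
  have him : ∀ x y : ℝ, ((x : ℂ) + (y : ℂ) * I).im = y := by intro x y; simp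
  ---------------------------------------------------------------- three mass-free sides
  have hT2 : ∫ x in a..b, G ((x : ℂ) + (M : ℂ) * I) = 0 := by
    have e : (fun x : ℝ => G ((x : ℂ) + (M : ℂ) * I)) = fun _ => 0 := by
      funext x
      simp only [hGdef]
      rw [hφ0 _ (Or.inr ?_), zero_mul]
      rw [him]
      exact hR₁M.trans (le_abs_self M)
    rw [e, intervalIntegral.integral_zero]
  have hT3 : ∫ y in h..M, G ((b : ℂ) + (y : ℂ) * I) = 0 := by
    have e : (fun y : ℝ => G ((b : ℂ) + (y : ℂ) * I)) = fun _ => 0 := by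
      funext y
      simp only [hGdef]
      rw [hφ0 _ (Or.inl ?_), zero_mul]
      rw [hre, hb]
      exact le_abs_self R₁
    rw [e, intervalIntegral.integral_zero]
  have hT4 : ∫ y in h..M, G ((a : ℂ) + (y : ℂ) * I) = 0 := by
    have e : (fun y : ℝ => G ((a : ℂ) + (y : ℂ) * I)) = fun _ => 0 := by
      funext y
      simp only [hGdef]
      rw [hφ0 _ (Or.inl ?_), zero_mul]
      rw [hre, ha, abs_neg]
      exact le_abs_self R₁
    rw [e, intervalIntegral.integral_zero]
  rw [hT2, hT3, hT4, sub_zero, smul_zero, add_zero, sub_zero] at key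
  simp only [hf'I, intervalIntegral.integral_const_mul] at key
  -- `key : ∫ x in a..b, G (x + h i) = 2 i ∫ x in a..b, ∫ y in h..M, Ψ (x + y i)`
  ---------------------------------------------------------------- Fubini: the area integral
  have hFub : ∫ z in {z : ℂ | h < z.im}, Ψ z =
      ∫ x in a..b, ∫ y in h..M, Ψ ((x : ℂ) + (y : ℂ) * I) := by
    set e : ℝ × ℝ ≃ᵐ ℂ := measurableEquivRealProd.symm with he
    have heap : ∀ p : ℝ × ℝ, e p = (p.1 : ℂ) + (p.2 : ℂ) * I := fun p => by
      rw [he, measurableEquivRealProd_symm_apply, mk_eq_add_mul_I]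
    have hmp : MeasurePreserving e volume volume := volume_preserving_equiv_real_prod.symm _
    have h1 : ∫ z in {z : ℂ | h < z.im}, Ψ z = ∫ p in e ⁻¹' {z : ℂ | h < z.im}, Ψ (e p) :=
      (hmp.setIntegral_preimage_emb e.measurableEmbedding Ψ _).symm
    have hpre : e ⁻¹' {z : ℂ | h < z.im} = (univ : Set ℝ) ×ˢ Ioi h := by
      ext p
      simp only [mem_preimage, mem_setOf_eq, heap, him, mem_prod, mem_univ, true_and, mem_Ioi]
    have h2 : ∫ p in (univ : Set ℝ) ×ˢ Ioi h, Ψ (e p) = ∫ p in Icc a b ×ˢ Ioc h M, Ψ (e p) := by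
      refine setIntegral_eq_of_subset_of_forall_sdiff_eq_zero
        (MeasurableSet.univ.prod measurableSet_Ioi) (prod_mono (subset_univ _) Ioc_subset_Ioi_self) ?_
      rintro p ⟨hp, hps⟩
      have hp2 : h < p.2 := hp.2
      simp only [hΨdef]
      rw [hdφ0 _ ?_, zero_mul]
      rw [heap, hre, him]
      by_cases hp1 : p.1 ∈ Icc a b
      · have hpM : ¬ p.2 ≤ M := fun hle => hps ⟨hp1, hp2, hle⟩
        exact Or.inr ((hR₁M.trans (le_of_lt (not_le.1 hpM))).trans (le_abs_self _))
      · rw [mem_Icc, not_and_or, not_le, not_le, ha, hb] at hp1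
        refine Or.inl (le_abs.2 ?_)
        rcases hp1 with h' | h'
        · exact Or.inr (by linarith)
        · exact Or.inl h'.le
    have hint : IntegrableOn (fun p : ℝ × ℝ => Ψ (e p)) (Icc a b ×ˢ Ioc h M) (volume.prod volume) := by
      have hι : Continuous fun p : ℝ × ℝ => (e p : ℂ) := by
        have : (fun p : ℝ × ℝ => (e p : ℂ)) = fun p => (p.1 : ℂ) + (p.2 : ℂ) * I := funext heap
        rw [this]
        fun_prop
      have hc : ContinuousOn (fun p : ℝ × ℝ => Ψ (e p)) (Icc a b ×ˢ Icc h M) := by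
        refine hcontΨ.comp hι.continuousOn fun p hp => ?_
        show h ≤ (e p).im
        rw [heap, him]
        exact hp.2.1
      rw [← Measure.volume_eq_prod]
      exact (hc.integrableOn_compact (isCompact_Icc.prod isCompact_Icc)).mono_set
        (prod_mono subset_rfl Ioc_subset_Icc_self)
    have h3 : ∫ p in Icc a b ×ˢ Ioc h M, Ψ (e p) =
        ∫ x in Icc a b, ∫ y in Ioc h M, Ψ (e (x, y)) := by
      rw [Measure.volume_eq_prod]
      exact setIntegral_prod _ hint
    rw [h1, hpre, h2, h3, setIntegral_congr_set (Ioc_ae_eq_Icc (α := ℝ) (μ := volume)).symm,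
      intervalIntegral.integral_of_le hab]
    simp only [intervalIntegral.integral_of_le hhM.le, heap]
  ---------------------------------------------------------------- the bottom side as a line integral
  have hline : ∫ x : ℝ, G ((x : ℂ) + (h : ℂ) * I) = ∫ x in a..b, G ((x : ℂ) + (h : ℂ) * I) := by
    rw [intervalIntegral.integral_of_le hab]
    refine (setIntegral_eq_integral_of_forall_compl_eq_zero fun x hx => ?_).symm
    simp only [hGdef]
    rw [hφ0 _ (Or.inl ?_), zero_mul]
    rw [hre]
    rw [mem_Ioc, not_and_or, not_lt, not_le, ha, hb] at hx
    refine le_abs.2 ?_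
    rcases hx with h' | h'
    · exact Or.inr (by linarith)
    · exact Or.inl h'.le
  ---------------------------------------------------------------- conclusion
  have h2I : (2 : ℂ) * I ≠ 0 := mul_ne_zero two_ne_zero I_ne_zero
  calc ∫ z in {z : ℂ | h < z.im}, dbarAlong 1 φ z * u z
      = ∫ x in a..b, ∫ y in h..M, Ψ ((x : ℂ) + (y : ℂ) * I) := hFub
    _ = ((2 : ℂ) * I)⁻¹ * ((2 : ℂ) * I * ∫ x in a..b, ∫ y in h..M, Ψ ((x : ℂ) + (y : ℂ) * I)) := by
        rw [← mul_assoc, inv_mul_cancel₀ h2I, one_mul]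
    _ = ((2 : ℂ) * I)⁻¹ * ∫ x : ℝ, G ((x : ℂ) + (h : ℂ) * I) := by rw [← key, hline]
    _ = -(I / 2) * ∫ x : ℝ, φ ((x : ℂ) + (h : ℂ) * I) * u ((x : ℂ) + (h : ℂ) * I) := by
        rw [mul_inv, Complex.inv_I, hGdef]
        ring

/-- **Registered sub-goal `gateTrace_green_halfPlane`** (crux item stmt-CriticalPhenomena-14004, line
`polygon-parity-squeeze`, stub `stub_gateTrace`, mechanism (C), Green's formula for the candidate on
the gate half-ball): registry form (one `∀`-term) of `setIntegral_dbarAlong_mul_eq_boundary`.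
[folklore] -/
theorem gateTrace_green_halfPlane : ∀ (u φ : ℂ → ℂ) (h : ℝ) (V : Set ℂ), IsOpen V → DifferentiableOn ℂ u ({z : ℂ | h < z.im} ∩ V) → ContinuousOn u ({z : ℂ | h ≤ z.im} ∩ V) → ContDiff ℝ 1 φ → HasCompactSupport φ → tsupport φ ⊆ V → ∫ z in {z : ℂ | h < z.im}, Literature.Analysis.Complex.dbarAlong 1 φ z * u z = -(Complex.I / 2) * ∫ x : ℝ, φ ((x : ℂ) + (h : ℂ) * Complex.I) * u ((x : ℂ) + (h : ℂ) * Complex.I) :=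
  fun _ _ _ _ hV hu huc hφ hφc hφV => setIntegral_dbarAlong_mul_eq_boundary hV hu huc hφ hφc hφV

end Summit.CriticalPhenomena.SAWScalingLimit.Theorems.PolygonParitySqueeze.GateTrace

end
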